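import Summits.MatrixMultiplication.OmegaCensus.STPPVosperSlackTwoCheckersT
import Summits.MatrixMultiplication.OmegaCensus.STPPVosperSlackTwoLawABQ

/-!
# ω-census (abelian STPP census): ℤ₅₉ leaf L1 = {(2,2,2),(3,3,3)²} — slack-2 three-block law, case C rows (empty dead table), part 1 of 6 (kernel computations)

HONEST FRAMING (pub-omega census; verbatim): lottery ticket; floor = certified bounds/negative ranges.
Census STRUCTURE (seat pub-omega-stpp-2 gen 27 — rows service for the stpp-1 lineage's law, 2026-08-29), family (b2).  Rows for stpp-1 g33's three-block slack-2 law (checker `caseCDeadT` of `STPPVosperSlackTwoCheckersT.lean`; case C: Hamidoune–Rødseth shapes `Q ∈ qShapesC 3`, `P ∈ pShapesC 59 3` (174), pinned holed interval `Z° = [0,13] ∖ {h₀}`, `h₀ ∈ [1,13]`; the dead table is EMPTY — no configuration reaches stage 3 in the mirror, 236 264 nodes in all): `caseCDeadT 59 3 13 13 Q P h₀ [] = true`, chunked by `P`-index with the python node counts (stpp-1 g33 s2w_mirrorC2.py; farm calibration ≈ 2.5 ms per node on the first 10 `P`).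
Each theorem is ONE `decide +kernel` over one chunk (sized by a python cost mirror to stay under the default-heartbeat ceiling).
Assembly in `STPPVosperSlackTwoRows59L1CAsm.lean`.  Nothing here is progress on `ω`.
-/

namespace Summit.MatrixMultiplication.OmegaCensus.CubeNB.S2

/-- Rows chunk `[0, 8)`: every entry passes the kernel test. [folklore] -/
theorem rows59L1C_c0 : ((((pShapesC 59 3).drop 0).take 8).all fun P => (qShapesC 3).all fun Q => (List.range' 1 13).all fun h₀ => caseCDeadT 59 3 13 13 Q P h₀ []) = true := by
  decide +kernel

/-- Rows chunk `[8, 9)`: every entry passes the kernel test. [folklore] -/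
theorem rows59L1C_c1 : ((((pShapesC 59 3).drop 8).take 1).all fun P => (qShapesC 3).all fun Q => (List.range' 1 13).all fun h₀ => caseCDeadT 59 3 13 13 Q P h₀ []) = true := by
  decide +kernel

/-- Rows chunk `[9, 15)`: every entry passes the kernel test. [folklore] -/
theorem rows59L1C_c2 : ((((pShapesC 59 3).drop 9).take 6).all fun P => (qShapesC 3).all fun Q => (List.range' 1 13).all fun h₀ => caseCDeadT 59 3 13 13 Q P h₀ []) = true := by
  decide +kernel

end Summit.MatrixMultiplication.OmegaCensus.CubeNB.S2
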